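import Summits.HodgeConjecture.HodgeConjecture.Theorems.EndoscopicMiddleDegreeOrthogonalSplit
import Literature.AlgebraicGeometry.HodgeTheory.ComplexGysinCorrespondence
import Literature.AlgebraicGeometry.HodgeTheory.GysinHodgeClassLiftProofs
import Literature.AlgebraicGeometry.HodgeTheory.RationalClassesRingChange
import Literature.AlgebraicGeometry.HodgeTheory.HodgeTypeConjugation

/-!
# Crux `IsotypicMiddleClassesAlgebraic` (stmt-HodgeConjecture-14301), line B (`IdeatorTwoSketch`) —
# stub `stub_kernel`: the kernel of the incidence map, `F`-side

Helper file for the line skeleton `isotypicMiddleClassesAlgebraic_of_lineB` (registered stub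
`stub_kernel`). Notation: `n = m + 1`, `X` smooth projective of dimension `2n`, `F` a smooth
projective SURFACE, `Φ ∈ N^{m+2} H^{2(m+2)}((F ⊗ X)(ℂ); ℂ)` an algebraic class,

* INCIDENCE map `Φ_* k := corrAction μ hF hX _ Φ k = pr_{F*}(pr_X^* k ∪ Φ) ∈ H²(F(ℂ); ℂ)`
  (`corrAction_apply`, `rfl`), for `k ∈ H^{2n}(X(ℂ); ℂ)`;
* TRANSPOSE map `ᵗΦ y := pr_{X*}(pr_F^* y ∪ Φ) ∈ H^{2n}(X(ℂ); ℂ)` for `y ∈ H²(F(ℂ); ℂ)`.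

CLAIM (`stub_kernel`). Granted Hodge models, de Rham's theorem in multiplicative form,
Grothendieck's coniveau inclusion and the Kähler package `hardLefschetz_hodgeRiemann 2 F` on the
surface, and top-degree injectivity of `pr_{X*}`: a rational Hodge `(n,n)`-class `k` with
`k ∪ ᵗΦ y = 0` for every rational `(1,1)`-class `y` on `F` is killed by the incidence map,
`Φ_* k = 0`.

PROOF. (1) ADJUNCTION (`cup_corrAction_eq_zero_of_cup_transpose_eq_zero`): by the projection
formula `complexGysin_cup` twice, `k ∪ ᵗΦ y = pr_{X*}(pr_X^* k ∪ (pr_F^* y ∪ Φ))` and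
`y ∪ Φ_* k = pr_{F*}(pr_F^* y ∪ (pr_X^* k ∪ Φ))`; the two top-degree classes on `F ⊗ X` agree
(associativity and graded commutativity in even degrees), so `k ∪ ᵗΦ y = 0` and the injectivity of
`pr_{X*}` on `H^{top}((F ⊗ X)(ℂ))` give `Φ_* k ∪ y = 0` for every rational `(1,1)`-class `y`.
(2) `Φ_* k` lies in the `ℂ`-span `V_F` of the rational `(1,1)`-classes of `F`: `Φ` is a complex
combination of RATIONAL algebraic classes `Φᵢ` (`supportedClasses_le_span_isRationalClass`),
`(Φᵢ)_* k` is rational up to one non-zero scalar (`exists_smul_corrAction_isRationalClass`) and of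
type `(1,1)` (`isOfHodgeType_corrAction`, the `Φᵢ` being of type `(m+2, m+2)` by the coniveau
inclusion, cup products adding Hodge types by de Rham's theorem); these two lemmas are adapted
from `Theorems/NikulinTwinTransportNikulinSerreCarrierKappaActionHodge` (namespace
`…NikulinSerreCarrier.NeronSeveriIntertwiner`), restated privately here so that this file does not
depend on another route's thesis file.
(3) NON-DEGENERACY on `V_F` (`eq_zero_of_mem_span_hodge_of_cup_orthogonal`): the perfect pairing
(6.1) on rational `(1,1)`-classes (`hodgeClasses_cupPairing_nondegenerate_of_hodgeRiemann` from the
Kähler package) extends to their complex span — a finite `ℂ`-basis `bⱼ` of `V_F` among rational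
`(1,1)`-classes has a RATIONAL Gram matrix `g` w.r.t. a rational generator `ρ` of the line
`H⁴(F(ℂ); ℂ)`; `g` is invertible over `ℚ` (a rational combination orthogonal to all `bⱼ` is
orthogonal to every rational `(1,1)`-class, hence `0`), hence over `ℂ`, so the coordinates of a
`v ∈ V_F` orthogonal to all `bⱼ` vanish.

The hypothesis `hfst` (top-degree injectivity of `pr_{F*}`) of the registered signature is not
used: reassociating towards `pr_{X*}` only `hsnd` is needed.
-/

noncomputable section

-- `Summit.HodgeConjecture.HodgeConjecture.Theorems` is the mandated namespace (single-problem summit),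
-- flagged by `linter.dupNamespace` on every declaration; restated here for stand-alone elaboration.
set_option linter.dupNamespace false

open CategoryTheory MonoidalCategory CartesianMonoidalCategory
open Literature.AlgebraicGeometry Literature.AlgebraicGeometry.Motives
open Literature.AlgebraicGeometry.HodgeTheory Literature.AlgebraicTopology.SingularHomology
open scoped Manifold

namespace Summit.HodgeConjecture.HodgeConjecture.Theorems

/-- degree bookkeeping: incidence map -/
private theorem lineB_deg_incidence (m : ℕ) :
    2 * (m + 1) + 2 * (m + 2) = 2 * 1 + 2 * (2 * (m + 1)) := by ring

/-- degree bookkeeping: transpose map -/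
private theorem lineB_deg_transpose (m : ℕ) :
    2 * (1 + (m + 2)) + 2 * (2 * (m + 1)) = 2 * (m + 1) + 2 * (2 + 2 * (m + 1)) := by ring

/-- **`γ_*` is rational up to ONE non-zero scalar** (adapted from
`NikulinSerreCarrier.NeronSeveriIntertwiner.exists_smul_corrAction_isRationalClass`). For smooth
projective `W, X`, an orientation family `μ` with Poincaré duality and a RATIONAL class
`γ ∈ H^{2e}((W ⊗ X)(ℂ); ℂ)`, there is `u ∈ ℂ`, `u ≠ 0`, such that `u • γ_*(c) = u • pr_{W*}(pr_X^* c ∪ γ)`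
is rational for every rational `c ∈ Hᵃ(X(ℂ); ℂ)`: pull-backs and cup products of rational classes
are rational, a rational class is `ι x` for the change of coefficients `ι : H(–; ℚ) → H(–; ℂ)`, and
`pr_{W*}(ι x) = u' • ι(rational Gysin of x)` with ONE `u' ≠ 0`
(`complexGysin_ringChange_eq_smul_gysinMap`); `u = u'⁻¹`. In degrees above `2 dim (W ⊗ X)`,
`pr_{W*} = 0`. [cite: FultonYoungTableaux1997, Appendix B §B.1 (5)] [cite: VoisinHodgeI2002, §7.3.2] -/
private theorem exists_smul_corrAction_isRationalClass (μ : OrientationFamily)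
    (hμ : μ.HasPoincareDuality) {d n : ℕ} {W X : SchemeOver ℂ} (hW : IsSmoothProjective d W)
    (hX : IsSmoothProjective n X) {e a b : ℕ} (hab : a + 2 * e = b + 2 * n)
    {γ : complexBetti (W ⊗ X) (2 * e)} (hγ : IsRationalClass γ) :
    ∃ u : ℂ, u ≠ 0 ∧ ∀ c : complexBetti X a, IsRationalClass c →
      IsRationalClass (u • corrAction μ hW hX hab γ c) := by
  by_cases hdeg : a + 2 * e ≤ 2 * (d + n)
  · obtain ⟨νY⟩ := ComplexPoints.isOrientableOver ℚ (IsSmoothProjective.tensor_holds hW hX)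
    obtain ⟨νX, hνX⟩ := exists_ratOrientation_hasPoincareDuality hW
    obtain ⟨u, hu, hcomp⟩ := complexGysin_ringChange_eq_smul_gysinMap hμ
      (IsSmoothProjective.tensor_holds hW hX) hW (fst W X)
      (show a + 2 * e + (2 * (d + n) - (a + 2 * e)) = 2 * (d + n) by omega)
      (show b + (2 * (d + n) - (a + 2 * e)) = 2 * d by omega) νY νX hνX
    refine ⟨u⁻¹, inv_ne_zero hu, fun c hc ↦ ?_⟩
    have hz : IsRationalClass
        (cupProduct (rfl : a + 2 * e = a + 2 * e) (complexBetti.map (snd W X) a c) γ) :=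
      (hc.pullback _).cup _ hγ
    obtain ⟨x, hx⟩ := hz.exists_ringChange_eq
    rw [corrAction_apply, ← hx, hcomp x, smul_smul, inv_mul_cancel₀ hu, one_smul]
    exact HodgeTheory.isRationalClass_ringChange _
  · refine ⟨1, one_ne_zero, fun c _ ↦ ?_⟩
    rw [corrAction_apply, complexGysin_of_lt _ hW (fst W X) _ (by omega), LinearMap.zero_apply,
      smul_zero]
    exact IsRationalClass.zero

/-- **`γ_*` has bidegree `(e − dim X, e − dim X)` on Hodge types for `γ` of type `(e, e)`** (adapted
from `NikulinSerreCarrier.NeronSeveriIntertwiner.isOfHodgeType_corrAction`; Voisin I, §7.3.2: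
pull-back, cup product with a class of pure type and Gysin morphism are compatible with Hodge
types). Hypotheses: Hodge models `B` of `W ⊗ X` and `A` of `W` on which cup products add Hodge
types (`CupPreservesHodgeType`); the model-independence of `H^{p,q}` is the tree's theorem
`hodgePQ_independent_of_hodgeModel_holds`. If `c ∈ Hᵃ(X(ℂ))` is of type `(p, q)` then
`γ_*(c) ∈ Hᵇ(W(ℂ))` is of type `(p', q')`, `p' + dim X = p + e`, `q' + dim X = q + e`.
[cite: VoisinHodgeI2002, §7.3.2 (with Lemma 7.30)] -/
private theorem isOfHodgeType_corrAction (μ : OrientationFamily) {d n : ℕ} {W X : SchemeOver ℂ}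
    (hW : IsSmoothProjective d W) (hX : IsSmoothProjective n X) (B : HodgeModel (d + n) (W ⊗ X))
    (A : HodgeModel d W) (hcB : CupPreservesHodgeType (d + n) (W ⊗ X))
    (hcA : CupPreservesHodgeType d W) {e a b : ℕ} (hab : a + 2 * e = b + 2 * n)
    {γ : complexBetti (W ⊗ X) (2 * e)} (hγ : IsOfHodgeType (d + n) (W ⊗ X) (2 * e) e e γ)
    {p q p' q' : ℕ} (hp : p' + n = p + e) (hq : q' + n = q + e) {c : complexBetti X a}
    (hc : IsOfHodgeType n X a p q c) :
    IsOfHodgeType d W b p' q' (corrAction μ hW hX hab γ c) := by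
  have hI := hodgePQ_independent_of_hodgeModel_holds
  have h1 : IsOfHodgeType (d + n) (W ⊗ X) a p q (complexBetti.map (snd W X) a c) :=
    hc.map_of_independent hI (IsSmoothProjective.tensor_holds hW hX) hX B (snd W X)
  have h2 : IsOfHodgeType (d + n) (W ⊗ X) (a + 2 * e) (p + e) (q + e)
      (cupProduct (rfl : a + 2 * e = a + 2 * e) (complexBetti.map (snd W X) a c) γ) :=
    hcB rfl h1 hγ
  rw [corrAction_apply]
  exact isOfHodgeType_complexGysin_of_cupPreservesHodgeType hI μ
    (IsSmoothProjective.tensor_holds hW hX) hW B A hcB hcA (fst W X) (corrAction_degree d hab)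
    (by omega) (by omega) h2

/-- **Non-degeneracy of the cup product on the complex span of the rational Hodge `(k,k)`-classes
in the middle degree** (`dim X = k + k`). If every non-zero rational `(k,k)`-class has a rational
`(k,k)` partner with non-zero cup product (BFNP (6.1)), then a class `v` in the `ℂ`-SPAN of the
rational `(k,k)`-classes which is cup-orthogonal to all of them vanishes: choose a finite `ℂ`-basis
`bⱼ` of the span among rational `(k,k)`-classes (`exists_linearIndependent`) and a rational generator
`ρ` of the line `H^{4k}(X(ℂ); ℂ)`; the Gram matrix `bᵢ ∪ bⱼ = gᵢⱼ ρ` is RATIONAL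
(`exists_eq_ratCast_smul_of_isRationalClass`); a rational combination `Σ qᵢ bᵢ` orthogonal to all
`bⱼ` is orthogonal to every rational `(k,k)`-class, hence `0` by the pairing, hence `q = 0`
(`linearIndependent_iff_of_isRationalClass`) — so `g` is invertible over `ℚ`
(`Matrix.vecMul_injective_iff_isUnit`), hence over `ℂ`, and the coordinates `c` of `v`, which solve
`c ᵥ* g = 0`, vanish. [cite: BrosnanFangNiePearlstein2009, §6 (6.1)]
[cite: VoisinHodgeI2002, §7.1.1 and proof of Lemma 7.26] -/
private theorem eq_zero_of_mem_span_hodge_of_cup_orthogonal {d k s : ℕ} {X : SchemeOver ℂ}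
    (hX : IsSmoothProjective d X) (A : HodgeModel d X) (hkk : k + k = d) (hs : 2 * k + 2 * k = s)
    (hP : ∀ c : complexBetti X (2 * k), IsRationalClass c → IsOfHodgeType d X (2 * k) k k c →
      c ≠ 0 → ∃ a : complexBetti X (2 * k), IsRationalClass a ∧ IsOfHodgeType d X (2 * k) k k a ∧
        cupProduct hs c a ≠ 0)
    {v : complexBetti X (2 * k)}
    (hv : v ∈ Submodule.span ℂ {y : complexBetti X (2 * k) | IsRationalClass y ∧
      IsOfHodgeType d X (2 * k) k k y})
    (horth : ∀ y : complexBetti X (2 * k), IsRationalClass y → IsOfHodgeType d X (2 * k) k k y →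
      cupProduct hs v y = 0) :
    v = 0 := by
  classical
  obtain rfl : s = 2 * d := by omega
  haveI := finite_complexBetti hX (2 * k)
  set S : Set (complexBetti X (2 * k)) := {y : complexBetti X (2 * k) | IsRationalClass y ∧
      IsOfHodgeType d X (2 * k) k k y} with hSdef
  obtain ⟨b, hbS, hbspan, hli⟩ := exists_linearIndependent ℂ S
  have hbfin : b.Finite := hli.set_finite_of_isNoetherian
  haveI : Fintype b := hbfin.fintype
  have hbQ : ∀ i : b, IsRationalClass (i : complexBetti X (2 * k)) := fun i ↦ (hbS i.2).1
  have hbT : ∀ i : b, IsOfHodgeType d X (2 * k) k k (i : complexBetti X (2 * k)) :=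
    fun i ↦ (hbS i.2).2
  -- the line `H^{2d}(X(ℂ); ℂ)` and a rational generator `ρ`
  have htop : Module.finrank ℂ (complexBetti X (2 * d)) = 1 := finrank_complexBetti_two_mul_eq_one hX
  obtain ⟨ρ, hρQ, hρ0⟩ : ∃ ρ : complexBetti X (2 * d), IsRationalClass ρ ∧ ρ ≠ 0 := by
    by_contra h
    push Not at h
    have hbot : Submodule.span ℂ {x : complexBetti X (2 * d) | IsRationalClass x} = ⊥ :=
      Submodule.span_eq_bot.2 h
    have htop' := span_isRationalClass_eq_top_of_isSmoothProjective_holds _ X hX (2 * d)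
    rw [hbot] at htop'
    haveI : Nontrivial (complexBetti X (2 * d)) := Module.nontrivial_of_finrank_eq_succ htop
    exact bot_ne_top htop'
  -- the RATIONAL Gram matrix `g` of the basis `b`
  choose g hg using fun i j : b ↦
    exists_eq_ratCast_smul_of_isRationalClass htop hρQ hρ0 ((hbQ i).cup hs (hbQ j))
  -- `(Σ cᵢ bᵢ) ∪ bⱼ = (Σ cᵢ gᵢⱼ) ρ`
  have key : ∀ (c : b → ℂ) (j : b),
      cupProduct hs (∑ i, c i • (i : complexBetti X (2 * k))) (j : complexBetti X (2 * k)) =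
        (∑ i, c i * ((g i j : ℚ) : ℂ)) • ρ := by
    intro c j
    simp only [map_sum, map_smul, LinearMap.sum_apply, LinearMap.smul_apply, hg, smul_smul,
      ← Finset.sum_smul]
  -- (ℚ) a rational combination of the `bᵢ` orthogonal to all `bⱼ` is trivial
  have hN : ∀ q : b → ℚ, Matrix.vecMul q (Matrix.of g) = 0 → q = 0 := by
    intro q hq
    set t : complexBetti X (2 * k) := ∑ i, ((q i : ℚ) : ℂ) • (i : complexBetti X (2 * k)) with ht
    have htQ : IsRationalClass t := IsRationalClass.sum_smul Finset.univ hbQ q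
    have htT : IsOfHodgeType d X (2 * k) k k t :=
      IsOfHodgeType.sum hX A Finset.univ _ fun i _ ↦ (hbT i).smul _
    have htb : ∀ j : b, cupProduct hs t (j : complexBetti X (2 * k)) = 0 := by
      intro j
      rw [ht, key]
      have h0 : ∑ i, ((q i : ℚ) : ℂ) * ((g i j : ℚ) : ℂ) =
          ((Matrix.vecMul q (Matrix.of g) j : ℚ) : ℂ) := by
        simp only [Matrix.vecMul, dotProduct, Matrix.of_apply, Rat.cast_sum, Rat.cast_mul]
      rw [h0, hq, Pi.zero_apply, Rat.cast_zero, zero_smul]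
    have htS : ∀ y ∈ S, cupProduct hs t y = 0 := by
      intro y hy
      have hy' : y ∈ Submodule.span ℂ b := by
        rw [hbspan]
        exact Submodule.subset_span hy
      exact LinearMap.mem_ker.1 ((Submodule.span_le (p := LinearMap.ker (cupProduct hs t))).2
        (fun x hx ↦ LinearMap.mem_ker.2 (htb ⟨x, hx⟩)) hy')
    have ht0 : t = 0 := by
      by_contra h0
      obtain ⟨a, haQ, haT, hne⟩ := hP t htQ htT h0
      exact hne (htS a ⟨haQ, haT⟩)
    rw [ht] at ht0
    exact (linearIndependent_iff_of_isRationalClass hbQ).1 hli q ht0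
  -- hence `g` is invertible over `ℚ`, and over `ℂ`
  have hinjQ : Function.Injective fun q : b → ℚ ↦ Matrix.vecMul q (Matrix.of g) := by
    intro q q' hqq'
    rw [← sub_eq_zero]
    refine hN (q - q') ?_
    simp only at hqq'
    rw [Matrix.sub_vecMul, hqq', sub_self]
  have hinjC : Function.Injective
      fun c : b → ℂ ↦ Matrix.vecMul c ((Rat.castHom ℂ).mapMatrix (Matrix.of g)) :=
    Matrix.vecMul_injective_of_isUnit
      ((Matrix.vecMul_injective_iff_isUnit.1 hinjQ).map (Rat.castHom ℂ).mapMatrix)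
  -- the coordinates `c` of `v` in the basis `b` solve `c ᵥ* g = 0`, hence vanish
  have hvb : v ∈ Submodule.span ℂ (Set.range ((↑) : b → complexBetti X (2 * k))) := by
    rwa [Subtype.range_coe, hbspan]
  obtain ⟨c, rfl⟩ := (Submodule.mem_span_range_iff_exists_fun ℂ).1 hvb
  suffices hc0 : c = 0 by simp [hc0]
  refine hinjC (funext fun j ↦ ?_)
  have h1 : Matrix.vecMul c ((Rat.castHom ℂ).mapMatrix (Matrix.of g)) j =
      ∑ i, c i * ((g i j : ℚ) : ℂ) := by
    simp only [Matrix.vecMul, dotProduct, RingHom.mapMatrix_apply, Matrix.map_apply,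
      Matrix.of_apply, Rat.coe_castHom]
  have h2 := horth _ (hbQ j) (hbT j)
  rw [key] at h2
  simp only
  rw [Matrix.zero_vecMul, Pi.zero_apply, h1]
  exact (smul_eq_zero.1 h2).resolve_right hρ0

/-- **Adjunction through the top degree of `F ⊗ X`.** For `k ∈ H^{2n}(X(ℂ))`, `y ∈ H²(F(ℂ))`,
`Φ ∈ H^{2(m+2)}((F ⊗ X)(ℂ))` (`n = m + 1`): the projection formula `complexGysin_cup` gives
`k ∪ ᵗΦ y = pr_{X*}(pr_X^* k ∪ (pr_F^* y ∪ Φ))` and `y ∪ Φ_* k = pr_{F*}(pr_F^* y ∪ (pr_X^* k ∪ Φ))`,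
and `pr_X^* k ∪ (pr_F^* y ∪ Φ) = pr_F^* y ∪ (pr_X^* k ∪ Φ)` in `H^{top}((F ⊗ X)(ℂ))`
(associativity, graded commutativity in even degrees). Hence if `k ∪ ᵗΦ y = 0` and `pr_{X*}` is
injective on the top degree, then `Φ_* k ∪ y = 0`. [cite: FultonYoungTableaux1997, Appendix B §B.1 (6)]
[cite: HatcherAT2002, §3.2 Thm. 3.11] -/
private theorem cup_corrAction_eq_zero_of_cup_transpose_eq_zero (μ : OrientationFamily)
    (hμ : μ.HasPoincareDuality) (m : ℕ) {X : SchemeOver ℂ} (hX : IsSmoothProjective (2 * (m + 1)) X)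
    {F : SchemeOver ℂ} (hF : IsSmoothProjective 2 F)
    (hsnd : ∀ {a b : ℕ} (hab : a + 2 * (2 * (m + 1)) = b + 2 * (2 + 2 * (m + 1))),
      a = 2 * (2 + 2 * (m + 1)) →
      Function.Injective (complexGysin μ (IsSmoothProjective.tensor_holds hF hX) hX (snd F X) hab))
    (Φ : complexBetti (F ⊗ X) (2 * (m + 2))) (k : complexBetti X (2 * (m + 1)))
    (y : complexBetti F (2 * 1))
    (h : cupProduct (two_mul_add_two_mul (m + 1) (m + 1)) k
        (complexGysin μ (IsSmoothProjective.tensor_holds hF hX) hX (snd F X) (lineB_deg_transpose m)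
          (cupProduct (two_mul_add_two_mul 1 (m + 2)) (complexBetti.map (fst F X) (2 * 1) y) Φ)) = 0) :
    cupProduct (two_mul_add_two_mul 1 1) (corrAction μ hF hX (lineB_deg_incidence m) Φ k) y = 0 := by
  -- X-side: `k ∪ ᵗΦ y = pr_{X*}(pr_X^* k ∪ (pr_F^* y ∪ Φ))`, so the top class vanishes
  have hpqX : 2 * (m + 1) + 2 * (1 + (m + 2)) = 2 * (2 + 2 * (m + 1)) := by ring
  have habX : 2 * (2 + 2 * (m + 1)) + 2 * (2 * (m + 1)) =
      2 * ((m + 1) + (m + 1)) + 2 * (2 + 2 * (m + 1)) := by ring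
  rw [← complexGysin_cup hμ (IsSmoothProjective.tensor_holds hF hX) hX (snd F X) hpqX habX
    (lineB_deg_transpose m) (two_mul_add_two_mul (m + 1) (m + 1)) k
    (cupProduct (two_mul_add_two_mul 1 (m + 2)) (complexBetti.map (fst F X) (2 * 1) y) Φ)] at h
  have hz := hsnd habX rfl (h.trans (map_zero _).symm)
  -- reorder: `pr_F^* y ∪ (pr_X^* k ∪ Φ) = pr_X^* k ∪ (pr_F^* y ∪ Φ)`
  have hpqF : 2 * 1 + (2 * (m + 1) + 2 * (m + 2)) = 2 * (2 + 2 * (m + 1)) := by ring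
  have h11 : 2 * (m + 1) + 2 * 1 = 2 * 1 + 2 * (m + 1) := by ring
  have hmid : 2 * 1 + 2 * (m + 1) + 2 * (m + 2) = 2 * (2 + 2 * (m + 1)) := by ring
  have hz' : cupProduct hpqF (complexBetti.map (fst F X) (2 * 1) y)
      (cupProduct (rfl : 2 * (m + 1) + 2 * (m + 2) = 2 * (m + 1) + 2 * (m + 2))
        (complexBetti.map (snd F X) (2 * (m + 1)) k) Φ) = 0 := by
    rw [← cupProduct_assoc (rfl : 2 * 1 + 2 * (m + 1) = 2 * 1 + 2 * (m + 1))
        (rfl : 2 * (m + 1) + 2 * (m + 2) = 2 * (m + 1) + 2 * (m + 2)) hmid hpqF,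
      cupProduct_gradedComm_holds ℂ (ComplexPoints (F ⊗ X))
        (rfl : 2 * 1 + 2 * (m + 1) = 2 * 1 + 2 * (m + 1)) h11
        (complexBetti.map (fst F X) (2 * 1) y) (complexBetti.map (snd F X) (2 * (m + 1)) k),
      Even.neg_one_pow ⟨2 * (m + 1), by ring⟩, one_smul,
      cupProduct_assoc h11 (two_mul_add_two_mul 1 (m + 2)) hmid hpqX]
    exact hz
  -- F-side: `y ∪ Φ_* k = pr_{F*}(pr_F^* y ∪ (pr_X^* k ∪ Φ)) = 0`
  have habF : 2 * (2 + 2 * (m + 1)) + 2 * 2 = 2 * (1 + 1) + 2 * (2 + 2 * (m + 1)) := by ring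
  have hF' := complexGysin_cup hμ (IsSmoothProjective.tensor_holds hF hX) hF (fst F X) hpqF habF
    (corrAction_degree 2 (lineB_deg_incidence m)) (two_mul_add_two_mul 1 1) y
    (cupProduct (rfl : 2 * (m + 1) + 2 * (m + 2) = 2 * (m + 1) + 2 * (m + 2))
      (complexBetti.map (snd F X) (2 * (m + 1)) k) Φ)
  rw [cupProduct_gradedComm_holds ℂ (ComplexPoints F) (two_mul_add_two_mul 1 1)
      (two_mul_add_two_mul 1 1) _ y, Even.neg_one_pow ⟨2, by norm_num⟩, one_smul,
    corrAction_apply, ← hF', hz', map_zero]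

/-- **Registered stub `stub_kernel`** (crux stmt-HodgeConjecture-14301, line `IdeatorTwoSketch`):
the kernel of the incidence map, `F`-side. Granted Hodge models (`hM`), de Rham's theorem in
multiplicative form (`hdR`), Grothendieck's coniveau inclusion (`hG`) and the Kähler package on the
SURFACE `F` (`hK`), and top-degree injectivity of the Gysin projection `pr_{X*}` of `F ⊗ X`
(`hsnd`; `hfst` is carried by the registered signature and not used): a rational Hodge
`(n,n)`-class `k` on `X` (`n = m + 1`, `dim X = 2n`) which is cup-orthogonal to every transpose
`ᵗΦ y = pr_{X*}(pr_F^* y ∪ Φ)` of a rational `(1,1)`-class `y` on `F` is KILLED by the incidence map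
`Φ_* = corrAction μ hF hX _ Φ`: (1) adjunction through the top degree of `F ⊗ X`
(`cup_corrAction_eq_zero_of_cup_transpose_eq_zero`) gives `Φ_* k ∪ y = 0` for all such `y`; (2)
`Φ_* k` lies in the `ℂ`-span of the rational `(1,1)`-classes of `F` (`Φ` is a complex combination of
rational algebraic classes, whose actions on the rational `(n,n)`-class `k` are rational up to a
scalar and of type `(1,1)`); (3) the cup product is non-degenerate there
(`eq_zero_of_mem_span_hodge_of_cup_orthogonal`, from BFNP (6.1) on the surface, i.e. hard Lefschetz +
Hodge–Riemann). [cite: BrosnanFangNiePearlstein2009, §6 (6.1)]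
[cite: VoisinHodgeI2002, Thm. 6.32 and §7.1.2] [cite: VoisinHodgeII2003, proof of Thm. 10.17 (10.7)] -/
theorem stub_kernel (hM : ∀ (d : ℕ) (Y : SchemeOver ℂ), nonempty_hodgeModel d Y)
    (hdR : ∀ (E : Type) [NormedAddCommGroup E] [NormedSpace ℂ E] [FiniteDimensional ℂ E],
      Literature.NumberTheory.Transcendental.exists_deRhamIsoFamily 𝓘(ℝ, E))
    (hG : Grothendieck1969_supportedClasses_le_hodgeConiveau)
    (μ : OrientationFamily) (hμ : μ.HasPoincareDuality) (m : ℕ) (X : SchemeOver ℂ)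
    (hX : IsSmoothProjective (2 * (m + 1)) X) (F : SchemeOver ℂ) (hF : IsSmoothProjective 2 F)
    (hK : hardLefschetz_hodgeRiemann 2 F)
    (hfst : ∀ {a b : ℕ} (hab : a + 2 * 2 = b + 2 * (2 + 2 * (m + 1))), a = 2 * (2 + 2 * (m + 1)) →
      Function.Injective (complexGysin μ (IsSmoothProjective.tensor_holds hF hX) hF (fst F X) hab))
    (hsnd : ∀ {a b : ℕ} (hab : a + 2 * (2 * (m + 1)) = b + 2 * (2 + 2 * (m + 1))),
      a = 2 * (2 + 2 * (m + 1)) →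
      Function.Injective (complexGysin μ (IsSmoothProjective.tensor_holds hF hX) hX (snd F X) hab))
    (Φ : complexBetti (F ⊗ X) (2 * (m + 2))) (hΦ : Φ ∈ algebraicClasses (F ⊗ X) (m + 2))
    (k : complexBetti X (2 * (m + 1))) (hkQ : IsRationalClass k)
    (hkT : IsOfHodgeType (2 * (m + 1)) X (2 * (m + 1)) (m + 1) (m + 1) k)
    (horth : ∀ y : complexBetti F (2 * 1), IsRationalClass y → IsOfHodgeType 2 F (2 * 1) 1 1 y →
      cupProduct (two_mul_add_two_mul (m + 1) (m + 1)) k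
        (complexGysin μ (IsSmoothProjective.tensor_holds hF hX) hX (snd F X) (lineB_deg_transpose m)
          (cupProduct (two_mul_add_two_mul 1 (m + 2)) (complexBetti.map (fst F X) (2 * 1) y) Φ)) = 0) :
    corrAction μ hF hX (lineB_deg_incidence m) Φ k = 0 := by
  -- only the `X`-side top-degree injectivity `hsnd` is needed (see the module docstring); the
  -- `F`-side one `hfst` is part of the registered signature and is merely acknowledged here
  have _ := @hfst
  have hI : hodgePQ_independent_of_hodgeModel := hodgePQ_independent_of_hodgeModel_holds
  have hT : IsSmoothProjective (2 + 2 * (m + 1)) (F ⊗ X) := IsSmoothProjective.tensor_holds hF hX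
  obtain ⟨A⟩ := (hM 2 F).nonempty hF
  obtain ⟨B⟩ := (hM _ _).nonempty hT
  have hcA : CupPreservesHodgeType 2 F :=
    cupPreservesHodgeType_of_nonempty_hodgeModel hI (hM 2 F) hdR hF
  have hcB : CupPreservesHodgeType (2 + 2 * (m + 1)) (F ⊗ X) :=
    cupPreservesHodgeType_of_nonempty_hodgeModel hI (hM _ _) hdR hT
  -- (2) `Φ_* k` lies in the complex span `V_F` of the rational `(1,1)`-classes of `F`
  have hmem : corrAction μ hF hX (lineB_deg_incidence m) Φ k ∈
      Submodule.span ℂ {y : complexBetti F (2 * 1) | IsRationalClass y ∧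
        IsOfHodgeType 2 F (2 * 1) 1 1 y} := by
    have hΦ' := supportedClasses_le_span_isRationalClass hT (2 * (m + 2)) (m + 2) hΦ
    refine (Submodule.span_le (p := Submodule.comap
      ((corrAction μ hF hX (lineB_deg_incidence m)).flip k)
      (Submodule.span ℂ {y : complexBetti F (2 * 1) | IsRationalClass y ∧
        IsOfHodgeType 2 F (2 * 1) 1 1 y}))).2 ?_ hΦ'
    rintro γ ⟨hγQ, hγA⟩
    rw [SetLike.mem_coe, Submodule.mem_comap, LinearMap.flip_apply]
    obtain ⟨u, hu, huQ⟩ :=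
      exists_smul_corrAction_isRationalClass μ hμ hF hX (lineB_deg_incidence m) hγQ
    have hγT : IsOfHodgeType (2 + 2 * (m + 1)) (F ⊗ X) (2 * (m + 2)) (m + 2) (m + 2) γ :=
      ⟨B, pullback_mem_hodgePQ_of_mem_supportedClasses hG hT B hγA⟩
    have h11 : IsOfHodgeType 2 F (2 * 1) 1 1 (corrAction μ hF hX (lineB_deg_incidence m) γ k) :=
      isOfHodgeType_corrAction μ hF hX B A hcB hcA (lineB_deg_incidence m) hγT (p := m + 1)
        (q := m + 1) (p' := 1) (q' := 1) (by omega) (by omega) hkT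
    rw [show corrAction μ hF hX (lineB_deg_incidence m) γ k =
        u⁻¹ • (u • corrAction μ hF hX (lineB_deg_incidence m) γ k) by
      rw [smul_smul, inv_mul_cancel₀ hu, one_smul]]
    exact Submodule.smul_mem _ _ (Submodule.subset_span ⟨huQ k hkQ, h11.smul u⟩)
  -- (3) non-degeneracy of `∪` on `V_F` (Kähler package on the surface), fed with (1) adjunction
  obtain ⟨Λ, hHR⟩ := hK hF
  have hP := Λ.hodgeClasses_cupPairing_nondegenerate_of_hodgeRiemann hI hHR
  refine eq_zero_of_mem_span_hodge_of_cup_orthogonal hF A (rfl : 1 + 1 = 2) (two_mul_add_two_mul 1 1)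
    (fun c hcQ hcT hc0 ↦ hP hF (2 * (1 + 1)) (rfl : 1 + 1 = 2) (two_mul_add_two_mul 1 1) c hcQ hcT hc0)
    hmem fun y hyQ hyT ↦ ?_
  exact cup_corrAction_eq_zero_of_cup_transpose_eq_zero μ hμ m hX hF hsnd Φ k y (horth y hyQ hyT)

end Summit.HodgeConjecture.HodgeConjecture.Theorems

end
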